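import Summits.Ventures.WeilGRH.WeilPrimeRippleBounds
import HarnessLib

/-!
# The twisted prime ripple: numeric trivial bounds by window and divisibility pattern

Cell `rh-explicit`, WEIL TRACK — GRH ARM, route B (weil-grh-3).  Accumulating the one-step bounds of
`WeilPrimeRippleBounds.lean`: decimal upper bounds of `|ρ_{χ,N'}(τ)|` (and of the difference
`ρ_{χ,7} − ρ_{χ,4}`) for the windows `N' = 3, 4, 7, 8` and the divisibility patterns of the modulus `q`
by the primes `≤ N'` (a prime `p ∣ q` kills the terms `n = p^e`).  These are the constants `B` of the
universal rungs (`DualTrigUniversal*.lean`): a key-free certificate with constant `log q_c` proves the rung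
for every character of its parity and every conductor `log q ≥ log q_c + B`.  Values (four decimals, each
an upper bound): `2Λ(2)/√2 ≤ 0.9803`, `2Λ(3)/√3 ≤ 1.2686`, `2Λ(4)/√4 ≤ 0.6932`, `2Λ(5)/√5 ≤ 1.4396`,
`2Λ(7)/√7 ≤ 1.4710`, `2Λ(8)/√8 ≤ 0.4902`.  Everything here is PROVED; no named facts.

## References

* A. Weil, *Sur les "formules explicites" de la théorie des nombres premiers* (1952), (11) pp. 261–262.
  [folklore consequences]
-/

noncomputable section

open Finset Real Complex

namespace Summit.Ventures.WeilGRH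

open Literature.NumberTheory.LFunctions
open scoped ArithmeticFunction.vonMangoldt

section patterns

variable {q : ℕ}

/-! ### All moduli

`B(1 → 3) ≤ 2.2489`, `B(1 → 4) ≤ 2.9421`, `B(1 → 7) ≤ 5.8527`, `B(1 → 8) ≤ 6.3429`, `B(4 → 7) ≤ 2.9106`,
for every modulus; the instance files subtract the coefficients of the primes dividing `q`. -/

/-- `|ρ_{χ,3}(τ)| ≤ 2.2489` for every Dirichlet character. [folklore] -/
theorem abs_weilPrimeRippleChar_three_le (χ : DirichletCharacter ℂ q) (τ : ℝ) :
    |weilPrimeRippleChar χ 3 τ| ≤ 22489 / 10000 := by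
  have h1 := weilPrimeRippleChar_one χ τ
  have h2 := abs_weilPrimeRippleChar_succ_sub_le χ (N := 1) (M := 2) rfl τ
  have h3 := abs_weilPrimeRippleChar_succ_sub_le χ (N := 2) (M := 3) rfl τ
  have c2 := two_vonMangoldt_div_sqrt_two_le
  have c3 := two_vonMangoldt_div_sqrt_three_le
  rw [abs_le] at h2 h3 ⊢
  constructor <;> linarith [h2.1, h2.2, h3.1, h3.2]

/-- `|ρ_{χ,4}(τ)| ≤ 2.9421` for every Dirichlet character. [folklore] -/
theorem abs_weilPrimeRippleChar_four_le (χ : DirichletCharacter ℂ q) (τ : ℝ) :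
    |weilPrimeRippleChar χ 4 τ| ≤ 29421 / 10000 := by
  have h3 := abs_weilPrimeRippleChar_three_le χ τ
  have h4 := abs_weilPrimeRippleChar_succ_sub_le χ (N := 3) (M := 4) rfl τ
  have c4 := two_vonMangoldt_div_sqrt_four_le
  rw [abs_le] at h3 h4 ⊢
  constructor <;> linarith [h4.1, h4.2]

/-- `|ρ_{χ,7}(τ) − ρ_{χ,4}(τ)| ≤ 2.9106` for every Dirichlet character. [folklore] -/
theorem abs_weilPrimeRippleChar_seven_sub_four_le (χ : DirichletCharacter ℂ q) (τ : ℝ) :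
    |weilPrimeRippleChar χ 7 τ - weilPrimeRippleChar χ 4 τ| ≤ 29106 / 10000 := by
  have h5 := abs_weilPrimeRippleChar_succ_sub_le χ (N := 4) (M := 5) rfl τ
  have h6 := weilPrimeRippleChar_succ_of_not_isPrimePow χ (N := 5) (M := 6) rfl not_isPrimePow_six τ
  have h7 := abs_weilPrimeRippleChar_succ_sub_le χ (N := 6) (M := 7) rfl τ
  have c5 := two_vonMangoldt_div_sqrt_five_le
  have c7 := two_vonMangoldt_div_sqrt_seven_le
  rw [abs_le] at h5 h7 ⊢
  constructor <;> linarith [h5.1, h5.2, h7.1, h7.2]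

/-- `|ρ_{χ,7}(τ)| ≤ 5.8527` for every Dirichlet character. [folklore] -/
theorem abs_weilPrimeRippleChar_seven_le (χ : DirichletCharacter ℂ q) (τ : ℝ) :
    |weilPrimeRippleChar χ 7 τ| ≤ 58527 / 10000 := by
  have h4 := abs_weilPrimeRippleChar_four_le χ τ
  have h7 := abs_weilPrimeRippleChar_seven_sub_four_le χ τ
  rw [abs_le] at h4 h7 ⊢
  constructor <;> linarith [h7.1, h7.2]

/-- `|ρ_{χ,8}(τ)| ≤ 6.3429` for every Dirichlet character. [folklore] -/
theorem abs_weilPrimeRippleChar_eight_le (χ : DirichletCharacter ℂ q) (τ : ℝ) :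
    |weilPrimeRippleChar χ 8 τ| ≤ 63429 / 10000 := by
  have h7 := abs_weilPrimeRippleChar_seven_le χ τ
  have h8 := abs_weilPrimeRippleChar_succ_sub_le χ (N := 7) (M := 8) rfl τ
  have c8 := two_vonMangoldt_div_sqrt_eight_le
  rw [abs_le] at h7 h8 ⊢
  constructor <;> linarith [h8.1, h8.2]

/-! ### Divisibility patterns of the modulus -/

/-- `|ρ_{χ,4}(τ)| ≤ 1.2686` when `2 ∣ q`. [folklore] -/
theorem abs_weilPrimeRippleChar_four_le_of_two_dvd (h2 : 2 ∣ q) (χ : DirichletCharacter ℂ q) (τ : ℝ) :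
    |weilPrimeRippleChar χ 4 τ| ≤ 6343 / 5000 := by
  have s1 := weilPrimeRippleChar_one χ τ
  have s2 := weilPrimeRippleChar_succ_of_not_coprime χ (N := 1) (M := 2) rfl
    (fun hc => by have := Nat.Coprime.eq_one_of_dvd (Nat.Coprime.coprime_dvd_left (dvd_refl 2) hc) h2; omega) τ
  have s3 := abs_le.1 (abs_weilPrimeRippleChar_succ_sub_le χ (N := 2) (M := 3) rfl τ)
  have c3 := two_vonMangoldt_div_sqrt_three_le
  have s4 := weilPrimeRippleChar_succ_of_not_coprime χ (N := 3) (M := 4) rfl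
    (fun hc => by have := Nat.Coprime.eq_one_of_dvd (Nat.Coprime.coprime_dvd_left (show 2 ∣ 4 by norm_num) hc) h2; omega) τ
  rw [abs_le]; constructor <;> linarith [s3.1, s3.2]

/-- `|ρ_{χ,4}(τ)| ≤ 1.6735` when `3 ∣ q`. [folklore] -/
theorem abs_weilPrimeRippleChar_four_le_of_three_dvd (h3 : 3 ∣ q) (χ : DirichletCharacter ℂ q) (τ : ℝ) :
    |weilPrimeRippleChar χ 4 τ| ≤ 3347 / 2000 := by
  have s1 := weilPrimeRippleChar_one χ τ
  have s2 := abs_le.1 (abs_weilPrimeRippleChar_succ_sub_le χ (N := 1) (M := 2) rfl τ)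
  have c2 := two_vonMangoldt_div_sqrt_two_le
  have s3 := weilPrimeRippleChar_succ_of_not_coprime χ (N := 2) (M := 3) rfl
    (fun hc => by have := Nat.Coprime.eq_one_of_dvd (Nat.Coprime.coprime_dvd_left (dvd_refl 3) hc) h3; omega) τ
  have s4 := abs_le.1 (abs_weilPrimeRippleChar_succ_sub_le χ (N := 3) (M := 4) rfl τ)
  have c4 := two_vonMangoldt_div_sqrt_four_le
  rw [abs_le]; constructor <;> linarith [s2.1, s2.2, s4.1, s4.2]

/-- `|ρ_{χ,4}(τ)| ≤ 0.0000` when `2 ∣ q`, `3 ∣ q`. [folklore] -/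
theorem abs_weilPrimeRippleChar_four_le_of_six_dvd (h2 : 2 ∣ q) (h3 : 3 ∣ q) (χ : DirichletCharacter ℂ q) (τ : ℝ) :
    |weilPrimeRippleChar χ 4 τ| ≤ 0 := by
  have s1 := weilPrimeRippleChar_one χ τ
  have s2 := weilPrimeRippleChar_succ_of_not_coprime χ (N := 1) (M := 2) rfl
    (fun hc => by have := Nat.Coprime.eq_one_of_dvd (Nat.Coprime.coprime_dvd_left (dvd_refl 2) hc) h2; omega) τ
  have s3 := weilPrimeRippleChar_succ_of_not_coprime χ (N := 2) (M := 3) rfl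
    (fun hc => by have := Nat.Coprime.eq_one_of_dvd (Nat.Coprime.coprime_dvd_left (dvd_refl 3) hc) h3; omega) τ
  have s4 := weilPrimeRippleChar_succ_of_not_coprime χ (N := 3) (M := 4) rfl
    (fun hc => by have := Nat.Coprime.eq_one_of_dvd (Nat.Coprime.coprime_dvd_left (show 2 ∣ 4 by norm_num) hc) h2; omega) τ
  rw [abs_le]; constructor <;> linarith

/-- `|ρ_{χ,7}(τ)| ≤ 4.1792` when `2 ∣ q`. [folklore] -/
theorem abs_weilPrimeRippleChar_seven_le_of_two_dvd (h2 : 2 ∣ q) (χ : DirichletCharacter ℂ q) (τ : ℝ) :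
    |weilPrimeRippleChar χ 7 τ| ≤ 2612 / 625 := by
  have s1 := weilPrimeRippleChar_one χ τ
  have s2 := weilPrimeRippleChar_succ_of_not_coprime χ (N := 1) (M := 2) rfl
    (fun hc => by have := Nat.Coprime.eq_one_of_dvd (Nat.Coprime.coprime_dvd_left (dvd_refl 2) hc) h2; omega) τ
  have s3 := abs_le.1 (abs_weilPrimeRippleChar_succ_sub_le χ (N := 2) (M := 3) rfl τ)
  have c3 := two_vonMangoldt_div_sqrt_three_le
  have s4 := weilPrimeRippleChar_succ_of_not_coprime χ (N := 3) (M := 4) rfl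
    (fun hc => by have := Nat.Coprime.eq_one_of_dvd (Nat.Coprime.coprime_dvd_left (show 2 ∣ 4 by norm_num) hc) h2; omega) τ
  have s5 := abs_le.1 (abs_weilPrimeRippleChar_succ_sub_le χ (N := 4) (M := 5) rfl τ)
  have c5 := two_vonMangoldt_div_sqrt_five_le
  have s6 := weilPrimeRippleChar_succ_of_not_isPrimePow χ (N := 5) (M := 6) rfl not_isPrimePow_six τ
  have s7 := abs_le.1 (abs_weilPrimeRippleChar_succ_sub_le χ (N := 6) (M := 7) rfl τ)
  have c7 := two_vonMangoldt_div_sqrt_seven_le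
  rw [abs_le]; constructor <;> linarith [s3.1, s3.2, s5.1, s5.2, s7.1, s7.2]

/-- `|ρ_{χ,7}(τ)| ≤ 4.5841` when `3 ∣ q`. [folklore] -/
theorem abs_weilPrimeRippleChar_seven_le_of_three_dvd (h3 : 3 ∣ q) (χ : DirichletCharacter ℂ q) (τ : ℝ) :
    |weilPrimeRippleChar χ 7 τ| ≤ 45841 / 10000 := by
  have s1 := weilPrimeRippleChar_one χ τ
  have s2 := abs_le.1 (abs_weilPrimeRippleChar_succ_sub_le χ (N := 1) (M := 2) rfl τ)
  have c2 := two_vonMangoldt_div_sqrt_two_le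
  have s3 := weilPrimeRippleChar_succ_of_not_coprime χ (N := 2) (M := 3) rfl
    (fun hc => by have := Nat.Coprime.eq_one_of_dvd (Nat.Coprime.coprime_dvd_left (dvd_refl 3) hc) h3; omega) τ
  have s4 := abs_le.1 (abs_weilPrimeRippleChar_succ_sub_le χ (N := 3) (M := 4) rfl τ)
  have c4 := two_vonMangoldt_div_sqrt_four_le
  have s5 := abs_le.1 (abs_weilPrimeRippleChar_succ_sub_le χ (N := 4) (M := 5) rfl τ)
  have c5 := two_vonMangoldt_div_sqrt_five_le
  have s6 := weilPrimeRippleChar_succ_of_not_isPrimePow χ (N := 5) (M := 6) rfl not_isPrimePow_six τ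
  have s7 := abs_le.1 (abs_weilPrimeRippleChar_succ_sub_le χ (N := 6) (M := 7) rfl τ)
  have c7 := two_vonMangoldt_div_sqrt_seven_le
  rw [abs_le]; constructor <;> linarith [s2.1, s2.2, s4.1, s4.2, s5.1, s5.2, s7.1, s7.2]

/-- `|ρ_{χ,7}(τ)| ≤ 4.4131` when `5 ∣ q`. [folklore] -/
theorem abs_weilPrimeRippleChar_seven_le_of_five_dvd (h5 : 5 ∣ q) (χ : DirichletCharacter ℂ q) (τ : ℝ) :
    |weilPrimeRippleChar χ 7 τ| ≤ 44131 / 10000 := by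
  have s1 := weilPrimeRippleChar_one χ τ
  have s2 := abs_le.1 (abs_weilPrimeRippleChar_succ_sub_le χ (N := 1) (M := 2) rfl τ)
  have c2 := two_vonMangoldt_div_sqrt_two_le
  have s3 := abs_le.1 (abs_weilPrimeRippleChar_succ_sub_le χ (N := 2) (M := 3) rfl τ)
  have c3 := two_vonMangoldt_div_sqrt_three_le
  have s4 := abs_le.1 (abs_weilPrimeRippleChar_succ_sub_le χ (N := 3) (M := 4) rfl τ)
  have c4 := two_vonMangoldt_div_sqrt_four_le
  have s5 := weilPrimeRippleChar_succ_of_not_coprime χ (N := 4) (M := 5) rfl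
    (fun hc => by have := Nat.Coprime.eq_one_of_dvd (Nat.Coprime.coprime_dvd_left (dvd_refl 5) hc) h5; omega) τ
  have s6 := weilPrimeRippleChar_succ_of_not_isPrimePow χ (N := 5) (M := 6) rfl not_isPrimePow_six τ
  have s7 := abs_le.1 (abs_weilPrimeRippleChar_succ_sub_le χ (N := 6) (M := 7) rfl τ)
  have c7 := two_vonMangoldt_div_sqrt_seven_le
  rw [abs_le]; constructor <;> linarith [s2.1, s2.2, s3.1, s3.2, s4.1, s4.2, s7.1, s7.2]

/-- `|ρ_{χ,7}(τ)| ≤ 4.3817` when `7 ∣ q`. [folklore] -/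
theorem abs_weilPrimeRippleChar_seven_le_of_seven_dvd (h7 : 7 ∣ q) (χ : DirichletCharacter ℂ q) (τ : ℝ) :
    |weilPrimeRippleChar χ 7 τ| ≤ 43817 / 10000 := by
  have s1 := weilPrimeRippleChar_one χ τ
  have s2 := abs_le.1 (abs_weilPrimeRippleChar_succ_sub_le χ (N := 1) (M := 2) rfl τ)
  have c2 := two_vonMangoldt_div_sqrt_two_le
  have s3 := abs_le.1 (abs_weilPrimeRippleChar_succ_sub_le χ (N := 2) (M := 3) rfl τ)
  have c3 := two_vonMangoldt_div_sqrt_three_le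
  have s4 := abs_le.1 (abs_weilPrimeRippleChar_succ_sub_le χ (N := 3) (M := 4) rfl τ)
  have c4 := two_vonMangoldt_div_sqrt_four_le
  have s5 := abs_le.1 (abs_weilPrimeRippleChar_succ_sub_le χ (N := 4) (M := 5) rfl τ)
  have c5 := two_vonMangoldt_div_sqrt_five_le
  have s6 := weilPrimeRippleChar_succ_of_not_isPrimePow χ (N := 5) (M := 6) rfl not_isPrimePow_six τ
  have s7 := weilPrimeRippleChar_succ_of_not_coprime χ (N := 6) (M := 7) rfl
    (fun hc => by have := Nat.Coprime.eq_one_of_dvd (Nat.Coprime.coprime_dvd_left (dvd_refl 7) hc) h7; omega) τ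
  rw [abs_le]; constructor <;> linarith [s2.1, s2.2, s3.1, s3.2, s4.1, s4.2, s5.1, s5.2]

/-- `|ρ_{χ,7}(τ)| ≤ 2.9106` when `2 ∣ q`, `3 ∣ q`. [folklore] -/
theorem abs_weilPrimeRippleChar_seven_le_of_six_dvd (h2 : 2 ∣ q) (h3 : 3 ∣ q) (χ : DirichletCharacter ℂ q) (τ : ℝ) :
    |weilPrimeRippleChar χ 7 τ| ≤ 14553 / 5000 := by
  have s1 := weilPrimeRippleChar_one χ τ
  have s2 := weilPrimeRippleChar_succ_of_not_coprime χ (N := 1) (M := 2) rfl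
    (fun hc => by have := Nat.Coprime.eq_one_of_dvd (Nat.Coprime.coprime_dvd_left (dvd_refl 2) hc) h2; omega) τ
  have s3 := weilPrimeRippleChar_succ_of_not_coprime χ (N := 2) (M := 3) rfl
    (fun hc => by have := Nat.Coprime.eq_one_of_dvd (Nat.Coprime.coprime_dvd_left (dvd_refl 3) hc) h3; omega) τ
  have s4 := weilPrimeRippleChar_succ_of_not_coprime χ (N := 3) (M := 4) rfl
    (fun hc => by have := Nat.Coprime.eq_one_of_dvd (Nat.Coprime.coprime_dvd_left (show 2 ∣ 4 by norm_num) hc) h2; omega) τ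
  have s5 := abs_le.1 (abs_weilPrimeRippleChar_succ_sub_le χ (N := 4) (M := 5) rfl τ)
  have c5 := two_vonMangoldt_div_sqrt_five_le
  have s6 := weilPrimeRippleChar_succ_of_not_isPrimePow χ (N := 5) (M := 6) rfl not_isPrimePow_six τ
  have s7 := abs_le.1 (abs_weilPrimeRippleChar_succ_sub_le χ (N := 6) (M := 7) rfl τ)
  have c7 := two_vonMangoldt_div_sqrt_seven_le
  rw [abs_le]; constructor <;> linarith [s5.1, s5.2, s7.1, s7.2]

/-- `|ρ_{χ,7}(τ)| ≤ 1.4710` when `2 ∣ q`, `3 ∣ q`, `5 ∣ q`. [folklore] -/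
theorem abs_weilPrimeRippleChar_seven_le_of_thirty_dvd (h2 : 2 ∣ q) (h3 : 3 ∣ q) (h5 : 5 ∣ q) (χ : DirichletCharacter ℂ q) (τ : ℝ) :
    |weilPrimeRippleChar χ 7 τ| ≤ 1471 / 1000 := by
  have s1 := weilPrimeRippleChar_one χ τ
  have s2 := weilPrimeRippleChar_succ_of_not_coprime χ (N := 1) (M := 2) rfl
    (fun hc => by have := Nat.Coprime.eq_one_of_dvd (Nat.Coprime.coprime_dvd_left (dvd_refl 2) hc) h2; omega) τ
  have s3 := weilPrimeRippleChar_succ_of_not_coprime χ (N := 2) (M := 3) rfl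
    (fun hc => by have := Nat.Coprime.eq_one_of_dvd (Nat.Coprime.coprime_dvd_left (dvd_refl 3) hc) h3; omega) τ
  have s4 := weilPrimeRippleChar_succ_of_not_coprime χ (N := 3) (M := 4) rfl
    (fun hc => by have := Nat.Coprime.eq_one_of_dvd (Nat.Coprime.coprime_dvd_left (show 2 ∣ 4 by norm_num) hc) h2; omega) τ
  have s5 := weilPrimeRippleChar_succ_of_not_coprime χ (N := 4) (M := 5) rfl
    (fun hc => by have := Nat.Coprime.eq_one_of_dvd (Nat.Coprime.coprime_dvd_left (dvd_refl 5) hc) h5; omega) τ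
  have s6 := weilPrimeRippleChar_succ_of_not_isPrimePow χ (N := 5) (M := 6) rfl not_isPrimePow_six τ
  have s7 := abs_le.1 (abs_weilPrimeRippleChar_succ_sub_le χ (N := 6) (M := 7) rfl τ)
  have c7 := two_vonMangoldt_div_sqrt_seven_le
  rw [abs_le]; constructor <;> linarith [s7.1, s7.2]

/-- `|ρ_{χ,7}(τ)| ≤ 0.0000` when `2 ∣ q`, `3 ∣ q`, `5 ∣ q`, `7 ∣ q`. [folklore] -/
theorem abs_weilPrimeRippleChar_seven_le_of_twohundredten_dvd (h2 : 2 ∣ q) (h3 : 3 ∣ q) (h5 : 5 ∣ q) (h7 : 7 ∣ q) (χ : DirichletCharacter ℂ q) (τ : ℝ) :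
    |weilPrimeRippleChar χ 7 τ| ≤ 0 := by
  have s1 := weilPrimeRippleChar_one χ τ
  have s2 := weilPrimeRippleChar_succ_of_not_coprime χ (N := 1) (M := 2) rfl
    (fun hc => by have := Nat.Coprime.eq_one_of_dvd (Nat.Coprime.coprime_dvd_left (dvd_refl 2) hc) h2; omega) τ
  have s3 := weilPrimeRippleChar_succ_of_not_coprime χ (N := 2) (M := 3) rfl
    (fun hc => by have := Nat.Coprime.eq_one_of_dvd (Nat.Coprime.coprime_dvd_left (dvd_refl 3) hc) h3; omega) τ
  have s4 := weilPrimeRippleChar_succ_of_not_coprime χ (N := 3) (M := 4) rfl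
    (fun hc => by have := Nat.Coprime.eq_one_of_dvd (Nat.Coprime.coprime_dvd_left (show 2 ∣ 4 by norm_num) hc) h2; omega) τ
  have s5 := weilPrimeRippleChar_succ_of_not_coprime χ (N := 4) (M := 5) rfl
    (fun hc => by have := Nat.Coprime.eq_one_of_dvd (Nat.Coprime.coprime_dvd_left (dvd_refl 5) hc) h5; omega) τ
  have s6 := weilPrimeRippleChar_succ_of_not_isPrimePow χ (N := 5) (M := 6) rfl not_isPrimePow_six τ
  have s7 := weilPrimeRippleChar_succ_of_not_coprime χ (N := 6) (M := 7) rfl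
    (fun hc => by have := Nat.Coprime.eq_one_of_dvd (Nat.Coprime.coprime_dvd_left (dvd_refl 7) hc) h7; omega) τ
  rw [abs_le]; constructor <;> linarith

end patterns

end Summit.Ventures.WeilGRH

end
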